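import Summits.Ventures.HSemireg.WedgeTopPairingEquivariance

/-!
# Venture HSemireg — THE WEDGE OF TWO CLASSES IS THE APOLAR PAIRING OF THEIR WINDOWS: `w_m(q) ∧ w_m(q′) = apolar_m(q, q′) · Π_{a<m} (x_a ∧ y_a)` with
# `apolar_m(q, q′) = (−1)^{m(m−1)/2} Σ_p (−1)^p C(m,p) q_p q′_{m−p}` (recursion `apolar_{m+1}(q,q′) = (−1)^m (apolar_m(q, σq′) − apolar_m(σq, q′))`), the classical `Sym^m`-invariant
# bilinear form — `(−1)^m`-symmetric, semi-invariant `apolar(g·q, g·q′) = (det g)^m apolar(q, q′)` under every substitution, and the degree-`n` kernel of a class cuts the class space in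
# the apolar hyperplane

HONEST FRAMING. Part of the Lean index of the computation cell `pub-hsemireg` (seat p10 gen 19, Sunday typer «UNIFORM-IN-n»).
Finite-dimensional EXTERIOR ALGEBRA over a field ONLY: no variety, no cohomology theory, no sheaf, no Ext group, no semiregularity map;
nothing here says that HC / HC_CM / HC_AV holds; no Literature fact is declared or used.  Custodian versions as in `WedgeHankelSiegelIdeal` (1/3); the dictionary (`w_n(q)` ↔ the binary form
with moments `q`; the apolar / transvectant pairing of two binary forms of degree `n`; for `q = q′` and `n = 2, 4`: the discriminant `2(q₀q₂ − q₁²)`, the invariant `2(q₀q₄ − 4q₁q₃ + 3q₂²)`)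
is QUOTED, never asserted.

WHAT IS IN THE TREE.  th-7's recursion `w_{m+1}(q) = w_m(q) x_m + w_m(σq) y_m`, `w_mem_Hom`, `x_mul_of_mem_Hom` (a letter passes a degree-`d` form with the sign `(−1)^d`), `gx_mul_self`,
`gy_mul_gx`; I13 `WedgeTopPairingEquivariance` (956): `volProd_eq_smul_B` (`Π_{a<m} x_a y_a = c·E_{Dm m}`, `c ≠ 0`), `Sb_volProd` (`Sb g (Π) = (det g)^m Π`), `eq_topCoeff_smul_B_univ`; H1 `Sb_w`;
H4 `Kr_w_top_eq_Ann_span`; I8 `exists_eq_w_of_mem_coSiegel`.  THIS FILE (namespace `Summit.Ventures.HSemireg.Wedge.KernelDuality` continued):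
* §200 **`apolar m q q′`** by the recursion `apolar 0 = q₀q′₀`, `apolar (m+1) q q′ = (−1)^m (apolar m q (σq′) − apolar m (σq) q′)`; `apolar_one`, `apolar_two` (`= −(q₀q′₂ − 2q₁q′₁ + q₂q′₀)`),
  bilinearity (`apolar_add_left/_right`, `apolar_smul_left/_right`), **`apolar_swap`: `apolar m q′ q = (−1)^m apolar m q q′`**, `apolar_self_eq_zero_of_odd`.
* §201 **THE WEDGE FORMULA `w_mul_w`: `w_m(q) ∧ w_m(q′) = apolar m q q′ · Π_{a<m} (x_a ∧ y_a)`** for `m ≤ n` (th-7's recursion: the `x·x` and `y·y` terms die, the two cross terms carry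
  `(−1)^m` from passing `x_m`, `y_m` through a degree-`m` class, and `y_m x_m = −x_m y_m`); hence **`topCoeff_w_mul_w`** (`τ(w_n(q) ∧ w_n(q′)) = c_n · apolar n q q′`, `c_n ≠ 0` the
  structure constant of I13), `w_mul_w_eq_zero_iff` (`w_n(q) ∧ w_n(q′) = 0 ⇔ apolar n q q′ = 0`), **`w_mem_Kr_w_top_iff`: `w_n(q′) ∈ Kr(univ, w_n q, n) ⇔ apolar n q′ q = 0`** — the
  degree-`n` kernel of a class meets the class space in the APOLAR HYPERPLANE of its window; `w_mul_self` and **`w_mul_self_eq_zero_of_odd`** (for odd `n` every class is isotropic).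
* §202 **SEMI-INVARIANCE `apolar_sbSeq`: `apolar m (sbSeq g m q) (sbSeq g m q′) = (αδ − βγ)^m · apolar m q q′`** for EVERY substitution (`Sb_w` + `Sb_volProd` + `Π ≠ 0`) — the classical
  invariance of the apolar form under `GL₂` (here all of `M₂`), e.g. `apolar_expMul` (translations `ν ↦ ν + λ` preserve it: `det = 1`).
NOT typed here: the closed form `(−1)^{m(m−1)/2} Σ_p (−1)^p C(m,p) q_p q′_{m−p}` as a `Finset.sum` identity (the recursion and the values `m ≤ 2` are typed; the general binomial
bookkeeping is left out); non-degeneracy of `apolar n` on windows (true iff every `C(n,p) ≠ 0` in `K`); anything Ext-side.  New names only.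
-/

open Module

namespace Summit.Ventures.HSemireg.Wedge.KernelDuality

open Summit.Ventures.HSemireg.Wedge Summit.Ventures.HSemireg.Wedge.Kunneth Summit.Ventures.HSemireg.Wedge.Hankel
  Summit.Ventures.HSemireg.Wedge.KunnethKernel Summit.Ventures.HSemireg.Wedge.HankelFrameChange Summit.Ventures.HSemireg.Wedge.HankelSiegel
  Summit.Ventures.HSemireg.Wedge.HankelSiegelIdeal

variable (K : Type*) [Field K] {n : ℕ}

/-! ## §200. The apolar pairing of two windows -/

/-- **THE APOLAR PAIRING** of two coefficient sequences in degree `m`, by th-7's recursion: `apolar 0 q q′ = q₀q′₀`, `apolar (m+1) q q′ = (−1)^m·(apolar m q (σq′) − apolar m (σq) q′)`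
(closed form `(−1)^{m(m−1)/2} Σ_p (−1)^p C(m,p) q_p q′_{m−p}`, dictionary: the apolar invariant of two binary forms). -/
def apolar : ℕ → (ℕ → K) → (ℕ → K) → K
  | 0, q, q' => q 0 * q' 0
  | m + 1, q, q' => (-1) ^ m * (apolar m q (shift K q') - apolar m (shift K q) q')

/-- `apolar 0 q q′ = q₀ q′₀`. -/
@[simp] lemma apolar_zero (q q' : ℕ → K) : apolar K 0 q q' = q 0 * q' 0 := rfl

/-- the recursion. -/
lemma apolar_succ (m : ℕ) (q q' : ℕ → K) : apolar K (m + 1) q q' = (-1) ^ m * (apolar K m q (shift K q') - apolar K m (shift K q) q') := rfl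

/-- `apolar 1 q q′ = q₀q′₁ − q₁q′₀` (the symplectic form on `K²`). -/
theorem apolar_one (q q' : ℕ → K) : apolar K 1 q q' = q 0 * q' 1 - q 1 * q' 0 := by
  rw [apolar_succ, apolar_zero, apolar_zero, shift_apply, shift_apply, pow_zero, one_mul]

/-- `apolar 2 q q′ = −(q₀q′₂ − 2q₁q′₁ + q₂q′₀)` (for `q = q′`: `−2(q₀q₂ − q₁²)`, the discriminant). -/
theorem apolar_two (q q' : ℕ → K) : apolar K 2 q q' = -(q 0 * q' 2 - 2 * (q 1 * q' 1) + q 2 * q' 0) := by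
  rw [apolar_succ, apolar_one, apolar_one]
  simp only [shift_apply]
  ring

/-- additivity in the first window. -/
theorem apolar_add_left : ∀ (m : ℕ) (q₁ q₂ q' : ℕ → K), apolar K m (fun j => q₁ j + q₂ j) q' = apolar K m q₁ q' + apolar K m q₂ q'
  | 0, _, _, _ => by simp only [apolar_zero]; ring
  | m + 1, q₁, q₂, q' => by
    have hs : shift K (fun j => q₁ j + q₂ j) = fun j => shift K q₁ j + shift K q₂ j := rfl
    rw [apolar_succ, apolar_succ, apolar_succ, hs, apolar_add_left m, apolar_add_left m]; ring

/-- additivity in the second window. -/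
theorem apolar_add_right : ∀ (m : ℕ) (q q₁ q₂ : ℕ → K), apolar K m q (fun j => q₁ j + q₂ j) = apolar K m q q₁ + apolar K m q q₂
  | 0, _, _, _ => by simp only [apolar_zero]; ring
  | m + 1, q, q₁, q₂ => by
    have hs : shift K (fun j => q₁ j + q₂ j) = fun j => shift K q₁ j + shift K q₂ j := rfl
    rw [apolar_succ, apolar_succ, apolar_succ, hs, apolar_add_right m, apolar_add_right m]; ring

/-- homogeneity in the first window. -/
theorem apolar_smul_left (c : K) : ∀ (m : ℕ) (q q' : ℕ → K), apolar K m (fun j => c * q j) q' = c * apolar K m q q'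
  | 0, _, _ => by simp only [apolar_zero]; ring
  | m + 1, q, q' => by
    have hs : shift K (fun j => c * q j) = fun j => c * shift K q j := rfl
    rw [apolar_succ, apolar_succ, hs, apolar_smul_left c m, apolar_smul_left c m]; ring

/-- homogeneity in the second window. -/
theorem apolar_smul_right (c : K) : ∀ (m : ℕ) (q q' : ℕ → K), apolar K m q (fun j => c * q' j) = c * apolar K m q q'
  | 0, _, _ => by simp only [apolar_zero]; ring
  | m + 1, q, q' => by
    have hs : shift K (fun j => c * q' j) = fun j => c * shift K q' j := rfl
    rw [apolar_succ, apolar_succ, hs, apolar_smul_right c m, apolar_smul_right c m]; ring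

/-- **`(−1)^m`-SYMMETRY: `apolar m q′ q = (−1)^m · apolar m q q′`** (symmetric in even degree, alternating in odd degree). -/
theorem apolar_swap : ∀ (m : ℕ) (q q' : ℕ → K), apolar K m q' q = (-1) ^ m * apolar K m q q'
  | 0, q, q' => by rw [apolar_zero, apolar_zero, pow_zero, one_mul, mul_comm]
  | m + 1, q, q' => by
    rw [apolar_succ, apolar_succ, apolar_swap m (shift K q) q', apolar_swap m q (shift K q'), pow_succ]; ring

/-- in ODD degree every window is apolar to itself. -/
theorem apolar_self_eq_zero_of_odd {m : ℕ} (hm : Odd m) (q : ℕ → K) : apolar K m q q + apolar K m q q = 0 := by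
  have h := apolar_swap K m q q
  rw [hm.neg_one_pow, neg_one_mul] at h
  linear_combination h

/-! ## §201. The wedge of two classes -/

/-- a letter `e_i`, put after a degree-`m` class on the first `m` pairs, passes it with the sign `(−1)^m`: `(f ∧ e_i) ∧ (g ∧ z) = (−1)^m · (f ∧ g) ∧ (e_i ∧ z)`. -/
lemma mul_gx_mul_eq {m : ℕ} {g : HT K (In n)} (hg : g ∈ Hom K (In n) (Dm n m) m) (i : In n) (f z : HT K (In n)) :
    f * gx K i * (g * z) = ((-1 : K) ^ m) • (f * g * (gx K i * z)) := by
  rw [mul_assoc, ← mul_assoc (gx K i), x_mul_of_mem_Hom K hg, smul_mul_assoc, mul_smul_comm]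
  simp only [mul_assoc]

/-- **THE WEDGE OF TWO CLASSES IS THE APOLAR PAIRING TIMES THE VOLUME PRODUCT: `w_m(q) ∧ w_m(q′) = apolar m q q′ · Π_{a<m} (x_a ∧ y_a)`** for `m ≤ n` (th-7's recursion: `x·x = y·y = 0`,
the cross terms carry `(−1)^m`, and `y_m x_m = −x_m y_m`). -/
theorem w_mul_w : ∀ {m : ℕ}, m ≤ n → ∀ q q' : ℕ → K,
    w K n m q * w K n m q' = apolar K m q q' • ((List.range m).map fun a => X K n a * Y K n a).prod
  | 0, _, q, q' => by
    rw [w, w, List.range_zero, List.map_nil, List.prod_nil, apolar_zero, smul_mul_smul_comm, mul_one]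
  | m + 1, hm, q, q' => by
    have hmn : m < n := by omega
    have hX : X K n m = gx K (xI m hmn) := by rw [X, dif_pos hmn]
    have hY : Y K n m = gx K (yI m hmn) := by rw [Y, dif_pos hmn]
    have hq' : w K n m q' ∈ Hom K (In n) (Dm n m) m := w_mem_Hom K hmn.le q'
    have hsq' : w K n m (shift K q') ∈ Hom K (In n) (Dm n m) m := w_mem_Hom K hmn.le (shift K q')
    rw [w, w, add_mul, mul_add, mul_add, hX, hY, mul_gx_mul_eq K hq', mul_gx_mul_eq K hsq', mul_gx_mul_eq K hq', mul_gx_mul_eq K hsq', gx_mul_self, gx_mul_self, gy_mul_gx K (xI m hmn) (yI m hmn)]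
    simp only [mul_zero, smul_zero, zero_add, add_zero, mul_neg, smul_neg]
    rw [w_mul_w hmn.le q (shift K q'), w_mul_w hmn.le (shift K q) q', List.range_succ, List.map_append, List.prod_append, List.map_singleton, List.prod_singleton, ← hX, ← hY,
      apolar_succ, smul_mul_assoc, smul_mul_assoc, smul_smul, smul_smul, ← sub_eq_add_neg, ← sub_smul]
    congr 1
    ring

/-- the wedge of two top classes, against the volume monomial: `w_n(q) ∧ w_n(q′) = (c_n · apolar n q q′) · E_univ` with I13's structure constant `c_n ≠ 0`. -/
theorem w_mul_w_top (q q' : ℕ → K) : ∃ c : K, c ≠ 0 ∧ w K n n q * w K n n q' = (c * apolar K n q q') • B K (In n) Finset.univ := by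
  obtain ⟨c, hc, e⟩ := volProd_eq_smul_B K (n := n) le_rfl
  rw [Dm_top] at e
  exact ⟨c, hc, by rw [w_mul_w K le_rfl, e, smul_smul, mul_comm]⟩

/-- **`τ(w_n(q) ∧ w_n(q′)) = c_n · apolar n q q′`** (`c_n ≠ 0` independent of `q, q′`). -/
theorem topCoeff_w_mul_w : ∃ c : K, c ≠ 0 ∧ ∀ q q' : ℕ → K, topCoeff K (w K n n q * w K n n q') = c * apolar K n q q' := by
  obtain ⟨c, hc, e⟩ := volProd_eq_smul_B K (n := n) le_rfl
  rw [Dm_top] at e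
  refine ⟨c, hc, fun q q' => ?_⟩
  rw [w_mul_w K le_rfl, e, smul_smul, map_smul, topCoeff_B_univ, smul_eq_mul, mul_one, mul_comm]

/-- **`w_n(q) ∧ w_n(q′) = 0` IFF the windows are APOLAR.** -/
theorem w_mul_w_eq_zero_iff (q q' : ℕ → K) : w K n n q * w K n n q' = 0 ↔ apolar K n q q' = 0 := by
  obtain ⟨c, hc, e⟩ := w_mul_w_top K q q'
  rw [e, smul_eq_zero, mul_eq_zero]
  have hB : B K (In n) Finset.univ ≠ 0 := (B K (In n)).ne_zero _
  constructor
  · rintro (h | h)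
    · exact h.resolve_left hc
    · exact absurd h hB
  · exact fun h => Or.inl (Or.inr h)

/-- **THE DEGREE-`n` KERNEL OF A CLASS MEETS THE CLASS SPACE IN THE APOLAR HYPERPLANE: `w_n(q′) ∈ Kr(univ, w_n q, n) ⇔ apolar n q′ q = 0`.** -/
theorem w_mem_Kr_w_top_iff (q q' : ℕ → K) : w K n n q' ∈ Kr K Finset.univ (w K n n q) n ↔ apolar K n q' q = 0 := by
  rw [mem_Kr, w_mul_w_eq_zero_iff]
  exact ⟨fun h => h.2, fun h => ⟨w_top_mem_Hom K q', h⟩⟩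

/-- the square of a class: `w_m(q) ∧ w_m(q) = apolar m q q · Π` (for even `m` the quadratic invariant: `m = 2` the discriminant, `m = 4` the invariant `i`; dictionary quoted). -/
theorem w_mul_self {m : ℕ} (hm : m ≤ n) (q : ℕ → K) : w K n m q * w K n m q = apolar K m q q • ((List.range m).map fun a => X K n a * Y K n a).prod :=
  w_mul_w K hm q q

/-- **in ODD degree every class is ISOTROPIC: `w_m(q) ∧ w_m(q) = 0`** (`m ≤ n`, characteristic `≠ 2`). -/
theorem w_mul_self_eq_zero_of_odd [NeZero (2 : K)] {m : ℕ} (hm : m ≤ n) (hodd : Odd m) (q : ℕ → K) : w K n m q * w K n m q = 0 := by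
  have h2 : apolar K m q q = 0 := by
    have h := apolar_self_eq_zero_of_odd K hodd q
    rw [← two_mul, mul_eq_zero] at h
    exact h.resolve_left (NeZero.ne 2)
  rw [w_mul_self K hm, h2, zero_smul]

/-! ## §202. Semi-invariance under every substitution -/

/-- the volume product of the first `m ≤ n` pairs is non-zero. -/
lemma volProd_ne_zero {m : ℕ} (hm : m ≤ n) : ((List.range m).map fun a => X K n a * Y K n a).prod ≠ 0 := by
  obtain ⟨c, hc, e⟩ := volProd_eq_smul_B K (n := n) hm
  rw [e, smul_ne_zero_iff]
  exact ⟨hc, (B K (In n)).ne_zero _⟩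

/-- **THE APOLAR PAIRING IS SEMI-INVARIANT: `apolar m (sbSeq g m q) (sbSeq g m q′) = (αδ − βγ)^m · apolar m q q′`** for EVERY substitution `g` and `m ≤ n` (`Sb_w`: both sides are the
coefficient of `Sb g (w_m(q) ∧ w_m(q′))` against `Π`). -/
theorem apolar_sbSeq (α β γ δ : K) {m : ℕ} (hm : m ≤ n) (q q' : ℕ → K) :
    apolar K m (sbSeq K α β γ δ m q) (sbSeq K α β γ δ m q') = (α * δ - β * γ) ^ m * apolar K m q q' := by
  have h : Sb K α β γ δ (w K n m q * w K n m q') = Sb K α β γ δ (w K n m q) * Sb K α β γ δ (w K n m q') := map_mul _ _ _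
  rw [Sb_w K α β γ δ hm, Sb_w K α β γ δ hm, w_mul_w K hm, w_mul_w K hm, map_smul, Sb_volProd, smul_smul] at h
  exact ((smul_left_injective K (volProd_ne_zero K hm) h).symm).trans (mul_comm _ _)

/-- e.g. translations of the nodes preserve the pairing: `apolar m (expMul λ q) (expMul λ q′) = apolar m q q′` (`m ≤ n`; `Φs λ = Sb 1 λ 0 1`, `det = 1`). -/
theorem apolar_expMul (lam : K) {m : ℕ} (hm : m ≤ n) (q q' : ℕ → K) : apolar K m (expMul K lam q) (expMul K lam q') = apolar K m q q' := by
  have h : Φs K lam (w K n m q * w K n m q') = Φs K lam (w K n m q) * Φs K lam (w K n m q') := map_mul _ _ _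
  rw [Φs_w K lam hm, Φs_w K lam hm, w_mul_w K hm, w_mul_w K hm, map_smul, ← AlgEquiv.coe_toAlgHom, Φs_eq_Sb, Sb_volProd, smul_smul] at h
  have h' := smul_left_injective K (volProd_ne_zero K hm) h
  simp only [mul_one, mul_zero, sub_zero, one_pow] at h'
  exact h'.symm

end Summit.Ventures.HSemireg.Wedge.KernelDuality
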